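import Literature.Analysis.FluidPDE.ElgindiWkProductRuleClosure
import Literature.Analysis.FluidPDE.ElgindiAprioriCutoff
import Literature.Analysis.FluidPDE.ElgindiTrigCoefficients
import Literature.Analysis.FluidPDE.ElgindiGammaKNumerics
import Literature.Analysis.FluidPDE.ElgindiWordTranspose
import HarnessLib

/-!
# Word bounds for separable multipliers and for the profile `F_*`; `|F_*g|_{𝓗⁴} ≲ (α/c_α)|g|_{𝓗⁴}`
([ElgindiGhoulMasmoudi2021] §2.3, §3 (the uses of Proposition 9.3 with the profile as the multiplier))

Topic `Literature/Analysis/FluidPDE`. Support file (definitions with bodies and proved theorems, no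
named facts) on the proof path of the named fact
`Literature.Analysis.FluidPDE.Elgindi.ElgindiGhoulMasmoudi2021_stabilityCore`
(`ElgindiStabilityDecomposition.lean`). T. M. Elgindi, T.-E. Ghoul, N. Masmoudi, Camb. J. Math. 9
(2021) = arXiv:1910.14071, §2.3 (p. 7: `F_* = (Γ/c)·4αz/(1+z)²`, "`F_*` is of order `α`") and §3
Proposition 3.3 (p. 11).

The multiplier product rule `eHkNormSq_mul_le_of_wordBounds` (`ElgindiWkProductRule.lean`) asks for
the a.e. word bounds `|D_z^jf| ≤ B`, `|D_θ^iD_z^jf| ≤ (γ−1+sin 2θ)B` (`i ≥ 1`). For a separable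
`f = R(z)G(θ)` these follow from `sup|Dz₁^jR| ≤ B_R`, `|G| ≤ B_G`, `|Dθ₁^iG| ≤ (γ−1+sin 2θ)B_G`
(`wordBounds_tensor`). For the profile `F_* = R ⊗ Γ` (`R = (4α/c)z/(1+z)²`): `|Dz₁^jR| ≤ C(4α/|c|)`
and `|Dθ₁^iΓ| ≤ C·α·Γ ≤ 10C(γ − 1)` (`ElgindiTrigCoefficients.lean`), so the bounds hold with
`B = B₀·α/|c_α|`, `B₀` absolute, for `0 < α ≤ 1` (`wordBounds_fundamentalProfile`); hence
`|F_*g|²_{𝓗⁴} ≤ prodBC·B₀²·(α/c_α)²·|g|²_{𝓗⁴}` on the closure class (`eHkNormSq_fundamentalProfile_mul_le`).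
-/

noncomputable section

open MeasureTheory Set Function Real Filter
open _root_.Topology
open scoped ENNReal ContDiff

namespace Literature.Analysis.FluidPDE

namespace Elgindi

/-! ### Separable multipliers -/

/-- **Word bounds of a separable multiplier `R ⊗ G`** on the strip. [folklore] -/
theorem wordBounds_tensor {α : ℝ} {R G : ℝ → ℝ} {BR BG : ℝ} (hBR : 0 ≤ BR)
    (hR : ∀ j ≤ 4, ∀ z, 0 < z → |(Dz₁^[j] R) z| ≤ BR)
    (hG0 : ∀ θ ∈ Ioo 0 (π / 2), |G θ| ≤ BG)
    (hG : ∀ i, 1 ≤ i → i ≤ 4 → ∀ θ ∈ Ioo 0 (π / 2), |(Dθ₁^[i] G) θ| ≤ qW α θ * BG) :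
    ∀ p ∈ strip, ∀ i j : ℕ, i + j ≤ 4 →
      |(Dθ^[i] (Dz^[j] (tensor R G))) p.1 p.2| ≤ (if i = 0 then 1 else qW α p.2) * (BR * BG) := by
  intro p hp i j hij
  rw [iterate_Dθ_Dz_tensor, tensor_apply, abs_mul]
  have hRj := hR j (by omega) p.1 hp.1
  have hBG : 0 ≤ BG := (abs_nonneg _).trans (hG0 p.2 hp.2)
  split_ifs with hi
  · subst hi
    rw [Function.iterate_zero, id_eq, one_mul]
    exact mul_le_mul hRj (hG0 p.2 hp.2) (abs_nonneg _) hBR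
  · have hGi := hG i (by omega) (by omega) p.2 hp.2
    calc |(Dz₁^[j] R) p.1| * |(Dθ₁^[i] G) p.2| ≤ BR * (qW α p.2 * BG) := mul_le_mul hRj hGi (abs_nonneg _) hBR
      _ = qW α p.2 * (BR * BG) := by ring

/-! ### The profile `F_*` -/

/-- The radial shape `S(z) = z/(1+z)²` has `|Dz₁^jS| ≤ C_j` on `z > 0` with absolute `C_j`. [folklore] -/
theorem exists_abs_iterate_Dz₁_shape_le (j : ℕ) :
    ∃ C : ℝ, 0 ≤ C ∧ ∀ z, 0 < z → |Dz₁^[j] (fun z : ℝ => z / (1 + z) ^ 2) z| ≤ C := by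
  have hf : ∀ z, 0 < z → (fun z : ℝ => z / (1 + z) ^ 2) z = (Polynomial.X - Polynomial.X ^ 2 : Polynomial ℝ).eval (1 + z)⁻¹ := by
    intro z hz
    have hz1 : (1 + z) ≠ 0 := by positivity
    have e : z / (1 + z) ^ 2 = (1 + z)⁻¹ - ((1 + z)⁻¹) ^ 2 := by field_simp; ring
    simp only [Polynomial.eval_sub, Polynomial.eval_X, Polynomial.eval_pow, e]
  obtain ⟨Q, hQ0, hQ⟩ := exists_iterate_Dz₁_eq_eval (P := Polynomial.X - Polynomial.X ^ 2) (by simp) hf j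
  obtain ⟨C, hC0, hC⟩ := exists_abs_eval_le_mul hQ0
  refine ⟨C, hC0, fun z hz => ?_⟩
  rw [hQ z hz]
  have hu0 : 0 ≤ (1 + z)⁻¹ := inv_nonneg.2 (by positivity)
  have hu1 : (1 + z)⁻¹ ≤ 1 := inv_le_one_of_one_le₀ (by linarith)
  exact (hC _ hu0 hu1).trans (by nlinarith)

/-- `profileRadial α = (4α/c)·S`. [folklore] -/
theorem profileRadial_eq_const_mul (α : ℝ) :
    profileRadial α = fun z => 4 * α / profileConst α * (fun z : ℝ => z / (1 + z) ^ 2) z := rfl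

/-- **Word bounds of the profile**: there is an absolute `B₀` with, for `0 < α ≤ 1`, on the strip,
`|D_z^jF_*| ≤ B₀·α/|c_α|` and `|D_θ^iD_z^jF_*| ≤ (γ − 1 + sin 2θ)·B₀·α/|c_α|` (`i ≥ 1`, `i + j ≤ 4`). [cite: ElgindiGhoulMasmoudi2021, §2.3 (p. 7 of arXiv:1910.14071): "F_* is of order α"] -/
theorem wordBounds_fundamentalProfile : ∃ B₀ : ℝ, 0 ≤ B₀ ∧ ∀ α ∈ Ioc (0:ℝ) 1, ∀ p ∈ strip, ∀ i j : ℕ, i + j ≤ 4 →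
    |(Dθ^[i] (Dz^[j] (fundamentalProfile α))) p.1 p.2| ≤
      (if i = 0 then 1 else qW α p.2) * (B₀ * (α / |profileConst α|)) := by
  -- radial constants
  obtain ⟨C0, hC00, hC0⟩ := exists_abs_iterate_Dz₁_shape_le 0
  obtain ⟨C1, hC10, hC1⟩ := exists_abs_iterate_Dz₁_shape_le 1
  obtain ⟨C2, hC20, hC2⟩ := exists_abs_iterate_Dz₁_shape_le 2
  obtain ⟨C3, hC30, hC3⟩ := exists_abs_iterate_Dz₁_shape_le 3
  obtain ⟨C4, hC40, hC4⟩ := exists_abs_iterate_Dz₁_shape_le 4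
  -- angular constants
  obtain ⟨A1, hA10, hA1⟩ := abs_iterate_Dθ₁_angularWeight_le 0
  obtain ⟨A2, hA20, hA2⟩ := abs_iterate_Dθ₁_angularWeight_le 1
  obtain ⟨A3, hA30, hA3⟩ := abs_iterate_Dθ₁_angularWeight_le 2
  obtain ⟨A4, hA40, hA4⟩ := abs_iterate_Dθ₁_angularWeight_le 3
  set CR := C0 + C1 + C2 + C3 + C4 with hCR
  set CA := 1 + 10 * (A1 + A2 + A3 + A4) with hCA
  refine ⟨4 * CR * CA, by positivity, fun α hα p hp i j hij => ?_⟩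
  have hα0 : 0 < α := hα.1
  have hαI : α ∈ Icc (0:ℝ) 1 := ⟨hα.1.le, hα.2⟩
  -- radial bound `|Dz₁^j R| ≤ (4α/|c|)·CR`
  have hRad : ∀ j' ≤ 4, ∀ z, 0 < z → |(Dz₁^[j'] (profileRadial α)) z| ≤ 4 * α / |profileConst α| * CR := by
    intro j' hj' z hz
    rw [profileRadial_eq_const_mul, iterate_Dz₁_const_mul', abs_mul, abs_div, abs_of_nonneg (by positivity : (0:ℝ) ≤ 4 * α)]
    refine mul_le_mul_of_nonneg_left ?_ (by positivity)
    interval_cases j'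
    · exact (hC0 z hz).trans (by rw [hCR]; linarith)
    · exact (hC1 z hz).trans (by rw [hCR]; linarith)
    · exact (hC2 z hz).trans (by rw [hCR]; linarith)
    · exact (hC3 z hz).trans (by rw [hCR]; linarith)
    · exact (hC4 z hz).trans (by rw [hCR]; linarith)
  -- angular bounds
  have hG0 : ∀ θ ∈ Ioo 0 (π / 2), |angularWeight α θ| ≤ CA := by
    intro θ hθ
    rw [abs_of_nonneg (angularWeight_nonneg α (Ioo_subset_Icc_self hθ))]
    exact (angularWeight_le_one hα0.le (Ioo_subset_Icc_self hθ)).trans (by rw [hCA]; nlinarith)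
  have hG : ∀ i', 1 ≤ i' → i' ≤ 4 → ∀ θ ∈ Ioo 0 (π / 2), |(Dθ₁^[i'] (angularWeight α)) θ| ≤ qW α θ * CA := by
    intro i' hi1 hi4 θ hθ
    have hΓ1 : angularWeight α θ ≤ 1 := angularWeight_le_one hα0.le (Ioo_subset_Icc_self hθ)
    have hΓ0 : 0 ≤ angularWeight α θ := angularWeight_nonneg α (Ioo_subset_Icc_self hθ)
    have hs : 0 < Real.sin (2 * θ) := Real.sin_pos_of_pos_of_lt_pi (by linarith [hθ.1]) (by linarith [hθ.2])
    have hq : α ≤ 10 * qW α θ := by unfold qW gammaExp; linarith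
    have hq0 : 0 ≤ qW α θ := by unfold qW gammaExp; linarith [hs.le]
    have key : ∀ {A : ℝ}, 0 ≤ A → A ≤ A1 + A2 + A3 + A4 → |(Dθ₁^[i'] (angularWeight α)) θ| ≤ A * α * angularWeight α θ →
        |(Dθ₁^[i'] (angularWeight α)) θ| ≤ qW α θ * CA := by
      intro A hA0 hAle h
      refine h.trans ?_
      calc A * α * angularWeight α θ ≤ A * α * 1 := by gcongr
        _ ≤ (A1 + A2 + A3 + A4) * (10 * qW α θ) := by rw [mul_one]; exact mul_le_mul hAle hq hα0.le (by linarith)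
        _ ≤ qW α θ * CA := by rw [hCA]; nlinarith
    obtain ⟨i'', rfl⟩ : ∃ i'', i' = i'' + 1 := ⟨i' - 1, by omega⟩
    have hi'' : i'' ≤ 3 := by omega
    interval_cases i''
    · exact key hA10 (by linarith) (hA1 α hαI θ hθ)
    · exact key hA20 (by linarith) (hA2 α hαI θ hθ)
    · exact key hA30 (by linarith) (hA3 α hαI θ hθ)
    · exact key hA40 (by linarith) (hA4 α hαI θ hθ)
  have h := wordBounds_tensor (α := α) (by positivity) hRad hG0 hG p hp i j hij
  rw [fundamentalProfile_eq_tensor]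
  refine h.trans (le_of_eq ?_)
  ring

/-- **`|F_*g|²_{𝓗⁴} ≤ prodBC·(B₀α/c_α)²·|g|²_{𝓗⁴}`** for `g` in the closure class, `0 < α ≤ 1`: the
`(P2)`-estimate with the profile as multiplier, with an `O(α²)` constant. [cite: ElgindiGhoulMasmoudi2021, §3 Proposition 3.3 (p. 11 of arXiv:1910.14071)] -/
theorem eHkNormSq_fundamentalProfile_mul_le : ∃ B₀ : ℝ, 0 ≤ B₀ ∧ ∀ α ∈ Ioc (0:ℝ) 1,
    ∀ {g : ℝ → ℝ → ℝ} {gs : ℕ → ℝ → ℝ → ℝ}, HkApprox α g gs →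
      eHkNormSq α 4 (fundamentalProfile α * g) ≤
        ENNReal.ofReal (prodBC * (B₀ * (α / |profileConst α|)) ^ 2) * eHkNormSq α 4 g := by
  obtain ⟨B₀, hB₀, hB⟩ := wordBounds_fundamentalProfile
  refine ⟨B₀, hB₀, fun α hα g gs hA => ?_⟩
  have hα10 : α ≤ 10 := hα.2.trans (by norm_num)
  have hF : ContDiffOn ℝ ∞ (uncurry (fundamentalProfile α)) strip := contDiffOn_fundamentalProfile α
  have hB0' : 0 ≤ B₀ * (α / |profileConst α|) := mul_nonneg hB₀ (div_nonneg hα.1.le (abs_nonneg _))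
  refine eHkNormSq_mul_le_of_wordBounds_closure hα.1 hα10 hF hB0' ?_ hA
  filter_upwards [ae_restrict_mem measurableSet_strip] with p hp
  exact hB α hα p hp

/-- **`|F_*g|²_{𝓗⁴} ≤ K·α²·|g|²_{𝓗⁴}`** for `0 < α ≤ 1/200` and `g` in the closure class, with an absolute
`K` (`c_α ≥ 49/50` there, `ElgindiGammaKNumerics.profileConst_ge`). [cite: ElgindiGhoulMasmoudi2021, §2.3 (p. 7 of arXiv:1910.14071): "F_* is of order α"] -/
theorem eHkNormSq_fundamentalProfile_mul_le_sq : ∃ K : ℝ, 0 ≤ K ∧ ∀ α ∈ Ioc (0:ℝ) (1 / 200),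
    ∀ {g : ℝ → ℝ → ℝ} {gs : ℕ → ℝ → ℝ → ℝ}, HkApprox α g gs →
      eHkNormSq α 4 (fundamentalProfile α * g) ≤ ENNReal.ofReal (K * α ^ 2) * eHkNormSq α 4 g := by
  obtain ⟨B₀, hB₀, hB⟩ := eHkNormSq_fundamentalProfile_mul_le
  refine ⟨prodBC * (B₀ * (50 / 49)) ^ 2, by have := prodBC_nonneg; positivity, fun α hα g gs hA => ?_⟩
  have hα1 : α ∈ Ioc (0:ℝ) 1 := ⟨hα.1, hα.2.trans (by norm_num)⟩
  refine (hB α hα1 hA).trans (mul_le_mul_left (ENNReal.ofReal_le_ofReal ?_) _)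
  have hc : (49 / 50 : ℝ) ≤ profileConst α := profileConst_ge hα.1.le hα.2
  have hca : |profileConst α| = profileConst α := abs_of_pos (by linarith)
  have hq : α / |profileConst α| ≤ 50 / 49 * α := by
    rw [hca, div_le_iff₀ (by linarith)]; nlinarith [hα.1]
  have h1 : B₀ * (α / |profileConst α|) ≤ B₀ * (50 / 49) * α := by nlinarith [mul_le_mul_of_nonneg_left hq hB₀]
  have h0 : 0 ≤ B₀ * (α / |profileConst α|) := mul_nonneg hB₀ (div_nonneg hα.1.le (abs_nonneg _))
  calc prodBC * (B₀ * (α / |profileConst α|)) ^ 2 ≤ prodBC * (B₀ * (50 / 49) * α) ^ 2 := by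
        refine mul_le_mul_of_nonneg_left (pow_le_pow_left₀ h0 h1 2) prodBC_nonneg
    _ = prodBC * (B₀ * (50 / 49)) ^ 2 * α ^ 2 := by ring

/-! ### The multipliers `D_zF_*` and `D_θF_*` -/

/-- **Word bounds of `D_zF_* = (Dz₁R) ⊗ Γ`**: the same shape as for `F_*` (absolute `B₀`, factor `α/|c_α|`). [cite: ElgindiGhoulMasmoudi2021, §3 Proposition 3.3 (p. 11 of arXiv:1910.14071): the term αV(Φ_ε)y∂_yF_*] -/
theorem wordBounds_Dz_fundamentalProfile : ∃ B₀ : ℝ, 0 ≤ B₀ ∧ ∀ α ∈ Ioc (0:ℝ) 1, ∀ p ∈ strip, ∀ i j : ℕ, i + j ≤ 4 →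
    |(Dθ^[i] (Dz^[j] (Dz (fundamentalProfile α)))) p.1 p.2| ≤
      (if i = 0 then 1 else qW α p.2) * (B₀ * (α / |profileConst α|)) := by
  obtain ⟨C1, hC10, hC1⟩ := exists_abs_iterate_Dz₁_shape_le 1
  obtain ⟨C2, hC20, hC2⟩ := exists_abs_iterate_Dz₁_shape_le 2
  obtain ⟨C3, hC30, hC3⟩ := exists_abs_iterate_Dz₁_shape_le 3
  obtain ⟨C4, hC40, hC4⟩ := exists_abs_iterate_Dz₁_shape_le 4
  obtain ⟨C5, hC50, hC5⟩ := exists_abs_iterate_Dz₁_shape_le 5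
  obtain ⟨A1, hA10, hA1⟩ := abs_iterate_Dθ₁_angularWeight_le 0
  obtain ⟨A2, hA20, hA2⟩ := abs_iterate_Dθ₁_angularWeight_le 1
  obtain ⟨A3, hA30, hA3⟩ := abs_iterate_Dθ₁_angularWeight_le 2
  obtain ⟨A4, hA40, hA4⟩ := abs_iterate_Dθ₁_angularWeight_le 3
  set CR := C1 + C2 + C3 + C4 + C5 with hCR
  set CA := 1 + 10 * (A1 + A2 + A3 + A4) with hCA
  refine ⟨4 * CR * CA, by positivity, fun α hα p hp i j hij => ?_⟩
  have hα0 : 0 < α := hα.1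
  have hαI : α ∈ Icc (0:ℝ) 1 := ⟨hα.1.le, hα.2⟩
  have hRad : ∀ j' ≤ 4, ∀ z, 0 < z → |(Dz₁^[j'] (Dz₁ (profileRadial α))) z| ≤ 4 * α / |profileConst α| * CR := by
    intro j' hj' z hz
    rw [← Function.iterate_succ_apply, profileRadial_eq_const_mul, iterate_Dz₁_const_mul', abs_mul, abs_div,
      abs_of_nonneg (by positivity : (0:ℝ) ≤ 4 * α)]
    refine mul_le_mul_of_nonneg_left ?_ (by positivity)
    interval_cases j'
    · exact (hC1 z hz).trans (by rw [hCR]; linarith)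
    · exact (hC2 z hz).trans (by rw [hCR]; linarith)
    · exact (hC3 z hz).trans (by rw [hCR]; linarith)
    · exact (hC4 z hz).trans (by rw [hCR]; linarith)
    · exact (hC5 z hz).trans (by rw [hCR]; linarith)
  have hG0 : ∀ θ ∈ Ioo 0 (π / 2), |angularWeight α θ| ≤ CA := by
    intro θ hθ
    rw [abs_of_nonneg (angularWeight_nonneg α (Ioo_subset_Icc_self hθ))]
    exact (angularWeight_le_one hα0.le (Ioo_subset_Icc_self hθ)).trans (by rw [hCA]; nlinarith)
  have hG : ∀ i', 1 ≤ i' → i' ≤ 4 → ∀ θ ∈ Ioo 0 (π / 2), |(Dθ₁^[i'] (angularWeight α)) θ| ≤ qW α θ * CA := by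
    intro i' hi1 hi4 θ hθ
    have hΓ1 : angularWeight α θ ≤ 1 := angularWeight_le_one hα0.le (Ioo_subset_Icc_self hθ)
    have hΓ0 : 0 ≤ angularWeight α θ := angularWeight_nonneg α (Ioo_subset_Icc_self hθ)
    have hs : 0 < Real.sin (2 * θ) := Real.sin_pos_of_pos_of_lt_pi (by linarith [hθ.1]) (by linarith [hθ.2])
    have hq : α ≤ 10 * qW α θ := by unfold qW gammaExp; linarith
    have key : ∀ {A : ℝ}, 0 ≤ A → A ≤ A1 + A2 + A3 + A4 → |(Dθ₁^[i'] (angularWeight α)) θ| ≤ A * α * angularWeight α θ →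
        |(Dθ₁^[i'] (angularWeight α)) θ| ≤ qW α θ * CA := by
      intro A hA0 hAle h
      refine h.trans ?_
      calc A * α * angularWeight α θ ≤ A * α * 1 := by gcongr
        _ ≤ (A1 + A2 + A3 + A4) * (10 * qW α θ) := by rw [mul_one]; exact mul_le_mul hAle hq hα0.le (by linarith)
        _ ≤ qW α θ * CA := by rw [hCA]; nlinarith
    obtain ⟨i'', rfl⟩ : ∃ i'', i' = i'' + 1 := ⟨i' - 1, by omega⟩
    have hi'' : i'' ≤ 3 := by omega
    interval_cases i''
    · exact key hA10 (by linarith) (hA1 α hαI θ hθ)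
    · exact key hA20 (by linarith) (hA2 α hαI θ hθ)
    · exact key hA30 (by linarith) (hA3 α hαI θ hθ)
    · exact key hA40 (by linarith) (hA4 α hαI θ hθ)
  have h := wordBounds_tensor (α := α) (by positivity) hRad hG0 hG p hp i j hij
  rw [fundamentalProfile_eq_tensor, Dz_tensor]
  refine h.trans (le_of_eq ?_)
  ring

/-- **Word bounds of `D_θF_* = R ⊗ (Dθ₁Γ)`**: here every angular word `Dθ₁^{i+1}Γ` carries the
factor `α`, but `Γ ≰ γ − 1 + sin 2θ` uniformly, so the multiplier constant is `B₀·α/|c_α|` with the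
`i = 0` bound `|D_z^jD_θF_*| ≤ B₀α/|c_α|` and the `i ≥ 1` bounds through `α ≤ 10(γ−1)`. [cite: ElgindiGhoulMasmoudi2021, §3 Proposition 3.3 (p. 11 of arXiv:1910.14071): the term U(Φ_ε)∂_θF_*] -/
theorem wordBounds_Dθ_fundamentalProfile : ∃ B₀ : ℝ, 0 ≤ B₀ ∧ ∀ α ∈ Ioc (0:ℝ) 1, ∀ p ∈ strip, ∀ i j : ℕ, i + j ≤ 4 →
    |(Dθ^[i] (Dz^[j] (Dθ (fundamentalProfile α)))) p.1 p.2| ≤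
      (if i = 0 then 1 else qW α p.2) * (B₀ * (α / |profileConst α|)) := by
  obtain ⟨C0, hC00, hC0⟩ := exists_abs_iterate_Dz₁_shape_le 0
  obtain ⟨C1, hC10, hC1⟩ := exists_abs_iterate_Dz₁_shape_le 1
  obtain ⟨C2, hC20, hC2⟩ := exists_abs_iterate_Dz₁_shape_le 2
  obtain ⟨C3, hC30, hC3⟩ := exists_abs_iterate_Dz₁_shape_le 3
  obtain ⟨C4, hC40, hC4⟩ := exists_abs_iterate_Dz₁_shape_le 4
  obtain ⟨A1, hA10, hA1⟩ := abs_iterate_Dθ₁_angularWeight_le 0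
  obtain ⟨A2, hA20, hA2⟩ := abs_iterate_Dθ₁_angularWeight_le 1
  obtain ⟨A3, hA30, hA3⟩ := abs_iterate_Dθ₁_angularWeight_le 2
  obtain ⟨A4, hA40, hA4⟩ := abs_iterate_Dθ₁_angularWeight_le 3
  obtain ⟨A5, hA50, hA5⟩ := abs_iterate_Dθ₁_angularWeight_le 4
  set CR := C0 + C1 + C2 + C3 + C4 with hCR
  set CA := A1 + 10 * (A2 + A3 + A4 + A5) with hCA
  refine ⟨4 * CR * CA, by positivity, fun α hα p hp i j hij => ?_⟩
  have hα0 : 0 < α := hα.1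
  have hαI : α ∈ Icc (0:ℝ) 1 := ⟨hα.1.le, hα.2⟩
  have hRad : ∀ j' ≤ 4, ∀ z, 0 < z → |(Dz₁^[j'] (profileRadial α)) z| ≤ 4 * α / |profileConst α| * CR := by
    intro j' hj' z hz
    rw [profileRadial_eq_const_mul, iterate_Dz₁_const_mul', abs_mul, abs_div, abs_of_nonneg (by positivity : (0:ℝ) ≤ 4 * α)]
    refine mul_le_mul_of_nonneg_left ?_ (by positivity)
    interval_cases j'
    · exact (hC0 z hz).trans (by rw [hCR]; linarith)
    · exact (hC1 z hz).trans (by rw [hCR]; linarith)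
    · exact (hC2 z hz).trans (by rw [hCR]; linarith)
    · exact (hC3 z hz).trans (by rw [hCR]; linarith)
    · exact (hC4 z hz).trans (by rw [hCR]; linarith)
  -- the angular factor `G = Dθ₁Γ`
  have hG0 : ∀ θ ∈ Ioo 0 (π / 2), |Dθ₁ (angularWeight α) θ| ≤ CA := by
    intro θ hθ
    have hΓ1 : angularWeight α θ ≤ 1 := angularWeight_le_one hα0.le (Ioo_subset_Icc_self hθ)
    have hΓ0 : 0 ≤ angularWeight α θ := angularWeight_nonneg α (Ioo_subset_Icc_self hθ)
    have h := hA1 α hαI θ hθ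
    rw [Function.iterate_one] at h
    refine h.trans ?_
    calc A1 * α * angularWeight α θ ≤ A1 * 1 * 1 := by gcongr; exact hα.2
      _ ≤ CA := by rw [hCA]; nlinarith
  have hG : ∀ i', 1 ≤ i' → i' ≤ 4 → ∀ θ ∈ Ioo 0 (π / 2), |(Dθ₁^[i'] (Dθ₁ (angularWeight α))) θ| ≤ qW α θ * CA := by
    intro i' hi1 hi4 θ hθ
    have hΓ1 : angularWeight α θ ≤ 1 := angularWeight_le_one hα0.le (Ioo_subset_Icc_self hθ)
    have hΓ0 : 0 ≤ angularWeight α θ := angularWeight_nonneg α (Ioo_subset_Icc_self hθ)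
    have hs : 0 < Real.sin (2 * θ) := Real.sin_pos_of_pos_of_lt_pi (by linarith [hθ.1]) (by linarith [hθ.2])
    have hq : α ≤ 10 * qW α θ := by unfold qW gammaExp; linarith
    rw [← Function.iterate_succ_apply]
    have key : ∀ {A : ℝ}, 0 ≤ A → A ≤ A2 + A3 + A4 + A5 → |(Dθ₁^[i' + 1] (angularWeight α)) θ| ≤ A * α * angularWeight α θ →
        |(Dθ₁^[i' + 1] (angularWeight α)) θ| ≤ qW α θ * CA := by
      intro A hA0 hAle h
      refine h.trans ?_
      calc A * α * angularWeight α θ ≤ A * α * 1 := by gcongr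
        _ ≤ (A2 + A3 + A4 + A5) * (10 * qW α θ) := by rw [mul_one]; exact mul_le_mul hAle hq hα0.le (by linarith)
        _ ≤ qW α θ * CA := by rw [hCA]; nlinarith [mul_nonneg (by linarith : (0:ℝ) ≤ qW α θ) hA10]
    interval_cases i'
    · exact key hA20 (by linarith) (hA2 α hαI θ hθ)
    · exact key hA30 (by linarith) (hA3 α hαI θ hθ)
    · exact key hA40 (by linarith) (hA4 α hαI θ hθ)
    · exact key hA50 (by linarith) (hA5 α hαI θ hθ)
  have h := wordBounds_tensor (α := α) (by positivity) hRad hG0 hG p hp i j hij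
  rw [fundamentalProfile_eq_tensor, Dθ_tensor]
  refine h.trans (le_of_eq ?_)
  ring

/-- **`|D_zF_*·g|²_{𝓗⁴}, |D_θF_*·g|²_{𝓗⁴} ≤ K·α²·|g|²_{𝓗⁴}`** for `0 < α ≤ 1/200`, `g` in the closure class. [cite: ElgindiGhoulMasmoudi2021, §3 Proposition 3.3 (p. 11 of arXiv:1910.14071)] -/
theorem eHkNormSq_D_fundamentalProfile_mul_le_sq : ∃ K : ℝ, 0 ≤ K ∧ ∀ α ∈ Ioc (0:ℝ) (1 / 200),
    ∀ {g : ℝ → ℝ → ℝ} {gs : ℕ → ℝ → ℝ → ℝ}, HkApprox α g gs →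
      eHkNormSq α 4 (Dz (fundamentalProfile α) * g) ≤ ENNReal.ofReal (K * α ^ 2) * eHkNormSq α 4 g ∧
      eHkNormSq α 4 (Dθ (fundamentalProfile α) * g) ≤ ENNReal.ofReal (K * α ^ 2) * eHkNormSq α 4 g := by
  obtain ⟨B₁, hB₁, hBz⟩ := wordBounds_Dz_fundamentalProfile
  obtain ⟨B₂, hB₂, hBθ⟩ := wordBounds_Dθ_fundamentalProfile
  set B₀ := max B₁ B₂ with hB₀def
  have hB₀ : 0 ≤ B₀ := hB₁.trans (le_max_left _ _)
  refine ⟨prodBC * (B₀ * (50 / 49)) ^ 2, by have := prodBC_nonneg; positivity, fun α hα g gs hA => ?_⟩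
  have hα1 : α ∈ Ioc (0:ℝ) 1 := ⟨hα.1, hα.2.trans (by norm_num)⟩
  have hα10 : α ≤ 10 := hα.2.trans (by norm_num)
  have hc : (49 / 50 : ℝ) ≤ profileConst α := profileConst_ge hα.1.le hα.2
  have hca : |profileConst α| = profileConst α := abs_of_pos (by linarith)
  have hq : α / |profileConst α| ≤ 50 / 49 * α := by
    rw [hca, div_le_iff₀ (by linarith)]; nlinarith [hα.1]
  have hr0 : 0 ≤ α / |profileConst α| := div_nonneg hα.1.le (abs_nonneg _)
  -- the common constant inequality
  have hK : ∀ {B : ℝ}, 0 ≤ B → B ≤ B₀ → ENNReal.ofReal (prodBC * (B * (α / |profileConst α|)) ^ 2) ≤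
      ENNReal.ofReal (prodBC * (B₀ * (50 / 49)) ^ 2 * α ^ 2) := by
    intro B hB hBle
    refine ENNReal.ofReal_le_ofReal ?_
    have h1 : B * (α / |profileConst α|) ≤ B₀ * (50 / 49) * α := by
      calc B * (α / |profileConst α|) ≤ B₀ * (50 / 49 * α) := mul_le_mul hBle hq hr0 hB₀
        _ = B₀ * (50 / 49) * α := by ring
    calc prodBC * (B * (α / |profileConst α|)) ^ 2 ≤ prodBC * (B₀ * (50 / 49) * α) ^ 2 :=
          mul_le_mul_of_nonneg_left (pow_le_pow_left₀ (mul_nonneg hB hr0) h1 2) prodBC_nonneg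
      _ = prodBC * (B₀ * (50 / 49)) ^ 2 * α ^ 2 := by ring
  have hF : ContDiffOn ℝ ∞ (uncurry (fundamentalProfile α)) strip := contDiffOn_fundamentalProfile α
  have hFz : ContDiffOn ℝ ∞ (uncurry (Dz (fundamentalProfile α))) strip := by
    have := contDiffOn_iterate_Dz_strip_infty hF 1; simpa using this
  have hFθ : ContDiffOn ℝ ∞ (uncurry (Dθ (fundamentalProfile α))) strip := contDiffOn_Dθ_strip_infty hF
  constructor
  · refine (eHkNormSq_mul_le_of_wordBounds_closure hα.1 hα10 hFz (mul_nonneg hB₁ hr0) ?_ hA).trans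
      (mul_le_mul_left (hK hB₁ (le_max_left _ _)) _)
    filter_upwards [ae_restrict_mem measurableSet_strip] with p hp
    exact hBz α hα1 p hp
  · refine (eHkNormSq_mul_le_of_wordBounds_closure hα.1 hα10 hFθ (mul_nonneg hB₂ hr0) ?_ hA).trans
      (mul_le_mul_left (hK hB₂ (le_max_right _ _)) _)
    filter_upwards [ae_restrict_mem measurableSet_strip] with p hp
    exact hBθ α hα1 p hp

end Elgindi

end Literature.Analysis.FluidPDE
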